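import Literature.AlgebraicGeometry.ModuliOfAbelianVarieties.SiegelCMReciprocitySimilitude
import Literature.NumberTheory.ComplexMultiplication.ReflexNormDeterminantTransitivity
import HarnessLib

/-!
# Rational torus elements are invisible in the reciprocity law (62): principal idèles act trivially on `Sh_K(GSp_δ, S^±)(ℂ)`

Topic `AlgebraicGeometry/ModuliOfAbelianVarieties`; namespace `Literature.AlgebraicGeometry.ModuliOfAbelianVarieties`.
THEOREMS ONLY (no definition, no named fact, no instance, no `sorry`).  Cell hodgecm-mathlib, road #60 (`SiegelS1`),
leaf R60-26 «rational torus elements are invisible in (62)» — the CONSISTENCY of the typed reciprocity law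
★ `SiegelRationalModel.IsCanonical` ([Deligne1971TravauxShimura] Déf. 3.13 / Thm. 4.21; [Milne2005ShimuraVarieties] Def. 12.8 (62)
`σ[x, a] = [x, r_x(s)·a]`) with `E^× ⊆ ker (art_E)`: at a PRINCIPAL finite idèle `s = (e)`, `e ∈ E^×`, the law must read
`[J, a] = [J, r(e)·a]`, and it does, for free, because `r(e)` is the image of a RATIONAL element of the torus of the special pair
which fixes `J`.

* §1 (σ2)-level: `[J, (q·a)K] = [J, aK]` for every `q ∈ GSp_δ(ℚ)` with `q·J·q⁻¹ = J` (★ `SiegelShimuraSet.mk_conjAct_smul`), and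
  `q·J·q⁻¹ = J` as soon as the real matrix of `q` commutes with `J`.
* §2 `cmRepMatrix` of a PRINCIPAL tuple `(xᵢ)_{𝔸} ∈ ∏ᵢ 𝔸_{Kᵢ,f}`, `x ∈ F = ∏ Kᵢ`, is the rational matrix `actMatrix x`
  (★ R60-1 `cmRepMatrix_eq_algHom`); hence the reciprocity element at a principal idèle,
  `c.cmRecipMatrix Φ E (e)_{𝔸} = actMatrix (N_{E,Φᵢ}(e))ᵢ` (★ `reflexNormFiniteIdele_unitEmbedding`: the reflex norm of a
  principal idèle is the principal idèle of the reflex norm [MilneCM2006] I Rem. 1.25).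
* §3 the rational torus element `q_e := act (N_{E,Φᵢ}(e))ᵢ` lies in `GSp_δ(ℚ)` with multiplier `Nm_{E/ℚ}(e)`
  ([MilneCM2006] I Rem. 1.24 (9): `N_Φ(e)·ι N_Φ(e) = Nm(e)`, ★ `reflexNormFrom_mul_complexConj_reflexNormFrom`, and the `ψ_δ`-adjointness
  of `act`, ★ `transpose_actMatrix_mul_typeFormOver`), and FIXES every `J` of a special pair `(c, J, Φ′)` (`IsSpecial`: `J` commutes
  with `act`).
* §4 HEAD: for every special pair, every `E ⊇ ∏ E*(Φᵢ)`, every `e ∈ E^×` and every `r ∈ GSp_δ(𝔸_f)` with matrix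
  `c.cmRecipMatrix Φ E (e)_{𝔸}` (the binder shape of `IsCanonical`): `[J, r·aK] = [J, aK]` for all `K`, `a` — so (62) at a
  principal idèle reads `σ • P = P`, consistent with `art_E((e)) = 1`.

## References
* [Deligne1971TravauxShimura] P. Deligne, *Travaux de Shimura* (1971), 3.9 p. 140 (reciprocity of tori, `E^×`-invariance),
  Déf. 3.13 p. 141, 4.18 p. 150, Thm. 4.21 p. 152.
* [Milne2005ShimuraVarieties] J. S. Milne, *Introduction to Shimura varieties* (2005), §5 (5.1) p. 56, Def. 12.8 (60)–(62) p. 114,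
  Ex. 12.4 (b) p. 112.
* [MilneCM2006] J. S. Milne, *Complex Multiplication* (2006), Ch. I §1 Rem. 1.24 (9), Rem. 1.25.
-/

set_option autoImplicit false

noncomputable section

open Matrix NumberField IsDedekindDomain
open scoped TensorProduct

namespace Literature.AlgebraicGeometry.ModuliOfAbelianVarieties

open Literature.NumberTheory.ComplexMultiplication
  (traceField ratFiniteAdeleTensorEquiv reflexNormFiniteIdele reflexNormFrom ratFiniteAdeleTensorEquiv_symm_algebraMap
    reflexNormFiniteIdele_unitEmbedding reflexNormFrom_mul_complexConj_reflexNormFrom reflexNormFrom_ne_zero)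

variable {g : ℕ} {δ : Fin g → ℕ}

/-! ### §1. `[J, (q·a)K] = [J, aK]` for rational `q` fixing `J` -/

section Sigma2

variable (δ) (L : Subgroup (gspFinAdelic δ))

/-- **Rational elements fixing `J` are invisible**: for `q ∈ GSp_δ(ℚ)` with `q·J·q⁻¹ = J`, `[J, (q·a)K] = [J, aK]` in
`Sh_K(GSp_δ, S^±)(ℂ) = GSp_δ(ℚ)∖(S^± × GSp_δ(𝔸_f)/K)` (the defining relation, ★ `SiegelShimuraSet.mk_conjAct_smul`).
[cite: Milne2005ShimuraVarieties, §5 (5.1) p. 56] [cite: Deligne1971TravauxShimura, 3.9 p. 140] -/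
theorem SiegelShimuraSet.mk_rationalToFinAdelic_mul (q : gspRational δ) (J : C0pm δ)
    (hq : conjAct δ (gspRationalToReal δ q) J = J) (a : gspFinAdelic δ) :
    SiegelShimuraSet.mk δ L J ((gspRationalToFinAdelic δ q : gspFinAdelic δ) * a) = SiegelShimuraSet.mk δ L J a := by
  conv_lhs => rw [← hq]
  exact SiegelShimuraSet.mk_conjAct_smul δ L q J a

/-- **`q·J·q⁻¹ = J` when the real matrix of `q` commutes with `J`.** [cite: Milne2005ShimuraVarieties, §6 p. 68] -/
theorem conjAct_gspRationalToReal_eq_self_of_commute (q : gspRational δ) (J : C0pm δ)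
    (h : (J : Matrix (Fin g ⊕ Fin g) (Fin g ⊕ Fin g) ℝ) *
        ((q : GL (Fin g ⊕ Fin g) ℚ) : Matrix (Fin g ⊕ Fin g) (Fin g ⊕ Fin g) ℚ).map (algebraMap ℚ ℝ) =
      ((q : GL (Fin g ⊕ Fin g) ℚ) : Matrix (Fin g ⊕ Fin g) (Fin g ⊕ Fin g) ℚ).map (algebraMap ℚ ℝ) *
        (J : Matrix (Fin g ⊕ Fin g) (Fin g ⊕ Fin g) ℝ)) :
    conjAct δ (gspRationalToReal δ q) J = J := by
  apply Subtype.ext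
  rw [coe_conjAct, conjJ_def, coe_gspRationalToReal]
  have hM : ((Matrix.GeneralLinearGroup.map (algebraMap ℚ ℝ) (q : GL (Fin g ⊕ Fin g) ℚ) : GL (Fin g ⊕ Fin g) ℝ) :
      Matrix (Fin g ⊕ Fin g) (Fin g ⊕ Fin g) ℝ) =
      ((q : GL (Fin g ⊕ Fin g) ℚ) : Matrix (Fin g ⊕ Fin g) (Fin g ⊕ Fin g) ℚ).map (algebraMap ℚ ℝ) := rfl
  rw [hM, ← h, Matrix.mul_assoc, ← hM, Units.mul_inv, Matrix.mul_one]

/-- Combined: `[J, (q·a)K] = [J, aK]` for `q ∈ GSp_δ(ℚ)` whose real matrix commutes with `J`.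
[cite: Milne2005ShimuraVarieties, §5 (5.1) p. 56] -/
theorem SiegelShimuraSet.mk_rationalToFinAdelic_mul_of_commute (q : gspRational δ) (J : C0pm δ)
    (h : (J : Matrix (Fin g ⊕ Fin g) (Fin g ⊕ Fin g) ℝ) *
        ((q : GL (Fin g ⊕ Fin g) ℚ) : Matrix (Fin g ⊕ Fin g) (Fin g ⊕ Fin g) ℚ).map (algebraMap ℚ ℝ) =
      ((q : GL (Fin g ⊕ Fin g) ℚ) : Matrix (Fin g ⊕ Fin g) (Fin g ⊕ Fin g) ℚ).map (algebraMap ℚ ℝ) *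
        (J : Matrix (Fin g ⊕ Fin g) (Fin g ⊕ Fin g) ℝ)) (a : gspFinAdelic δ) :
    SiegelShimuraSet.mk δ L J ((gspRationalToFinAdelic δ q : gspFinAdelic δ) * a) = SiegelShimuraSet.mk δ L J a :=
  SiegelShimuraSet.mk_rationalToFinAdelic_mul δ L q J (conjAct_gspRationalToReal_eq_self_of_commute δ q J h) a

end Sigma2

/-! ### §2. `cmRepMatrix` of principal tuples and `cmRecipMatrix` at principal idèles -/

namespace CMStructure

variable {ι : Type} [Fintype ι] [DecidableEq ι] {K : ι → Type} [∀ i, Field (K i)] [∀ i, NumberField (K i)]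
  [∀ i, IsCMField (K i)] (c : CMStructure g δ ι K)

/-- **A PRINCIPAL tuple acts by its rational matrix**: for `x ∈ F = ∏ᵢ Kᵢ`, the matrix on `𝔸_{ℚ,f}^{2g}` of the diagonal image
`((xᵢ)_{𝔸_{Kᵢ,f}})ᵢ ∈ ∏ᵢ 𝔸_{Kᵢ,f}` is `actMatrix x` with entries cast to `𝔸_{ℚ,f}` (★ R60-1 `cmRepMatrix_eq_algHom` at `1 ⊗ xᵢ`).
[cite: Deligne1971TravauxShimura, 3.9 p. 140 and 4.18 p. 150] -/
theorem cmRepMatrix_algebraMap (x : Π i, K i) :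
    c.cmRepMatrix (fun i => algebraMap (K i) (FiniteAdeleRing (𝓞 (K i)) (K i)) (x i)) =
      (c.actMatrix x).map (algebraMap ℚ finAdeleQ) := by
  obtain ⟨Θ, hΘ⟩ := c.exists_algHom_extending_actMatrix
  rw [c.cmRepMatrix_eq_algHom Θ hΘ]
  have h : (fun i => (ratFiniteAdeleTensorEquiv (K i)).symm
      (algebraMap (K i) (FiniteAdeleRing (𝓞 (K i)) (K i)) (x i))) = fun i => (1 : finAdeleQ) ⊗ₜ[ℚ] x i := by
    funext i
    rw [ratFiniteAdeleTensorEquiv_symm_algebraMap]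
  rw [h, hΘ, one_smul]

variable (Φ : ∀ i, Motives.CMType (K i)) (E : IntermediateField ℚ ℂ) [NumberField ↥E]

/-- **The reciprocity element at a PRINCIPAL idèle is rational**: for `e ∈ E^×`,
`c.cmRecipMatrix Φ E (e)_{𝔸} = actMatrix (N_{E,Φᵢ}(e))ᵢ` — the reflex norm of a principal idèle is the principal idèle of
the reflex norm (★ `reflexNormFiniteIdele_unitEmbedding`). [cite: MilneCM2006, Ch. I §1 Rem. 1.25 («compatible with N_0»)]
[cite: Milne2005ShimuraVarieties, Def. 12.8 (60)–(61) p. 114] -/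
theorem cmRecipMatrix_unitEmbedding (e : (↥E)ˣ) :
    c.cmRecipMatrix Φ E (FiniteAdeleRing.unitEmbedding (𝓞 ↥E) ↥E e) =
      (c.actMatrix (fun i => reflexNormFrom (K i) (Φ i) E (e : ↥E))).map (algebraMap ℚ finAdeleQ) := by
  unfold cmRecipMatrix
  have h : (fun i => ((reflexNormFiniteIdele (K i) (Φ i) E (FiniteAdeleRing.unitEmbedding (𝓞 ↥E) ↥E e) :
        (FiniteAdeleRing (𝓞 (K i)) (K i))ˣ) : FiniteAdeleRing (𝓞 (K i)) (K i))) =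
      fun i => algebraMap (K i) (FiniteAdeleRing (𝓞 (K i)) (K i)) (reflexNormFrom (K i) (Φ i) E (e : ↥E)) := by
    funext i
    rw [reflexNormFiniteIdele_unitEmbedding, FiniteAdeleRing.unitEmbedding_apply, Units.coe_map]
  rw [h, cmRepMatrix_algebraMap]

/-! ### §3. The rational torus element `act (N_{E,Φᵢ}(e))ᵢ ∈ GSp_δ(ℚ)` fixes `J` -/

omit [DecidableEq ι] in
/-- `act` of a rational scalar is the scalar matrix: `actMatrix (r·1_F) = r • 1`. [cite: Deligne1971TravauxShimura, 4.18 p. 150] -/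
theorem actMatrix_algebraMap (r : ℚ) : c.actMatrix (algebraMap ℚ (Π i, K i) r) = r • (1 : Matrix _ _ ℚ) := by
  rw [actMatrix_def, AlgHom.commutes, Module.algebraMap_end_eq_smul_id, map_smul, LinearMap.toMatrix'_id]

omit [DecidableEq ι] in
/-- **`act x` is a symplectic similitude when `x̄·x` is a rational scalar**: `(actMatrix x)ᵀ E_δ (actMatrix x) = r • E_δ` if
`x̄ᵢ xᵢ = r` for all `i` (★ `transpose_actMatrix_mul_typeFormOver`). [cite: Milne2005ShimuraVarieties, §6 p. 67 and Def. 12.8 (60) p. 114] -/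
theorem transpose_actMatrix_mul_typeFormOver_mul_actMatrix {x : Π i, K i} {r : ℚ}
    (hx : (fun i => IsCMField.complexConj (K i) (x i)) * x = algebraMap ℚ (Π i, K i) r) :
    (c.actMatrix x)ᵀ * typeFormOver δ ℚ * c.actMatrix x = r • typeFormOver δ ℚ := by
  classical
  rw [c.transpose_actMatrix_mul_typeFormOver, Matrix.mul_assoc, ← c.actMatrix_mul, hx, c.actMatrix_algebraMap,
    Matrix.mul_smul, Matrix.mul_one]

omit [Fintype ι] [DecidableEq ι] in
/-- The tuple of reflex norms of `e ∈ E^×` satisfies `N̄ᵢ Nᵢ = Nm_{E/ℚ}(e)` ([MilneCM2006] I Rem. 1.24 (9)).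
[cite: MilneCM2006, Ch. I §1 Rem. 1.24] -/
theorem conj_reflexNormFrom_mul_reflexNormFrom (hE : ∀ i, traceField (Φ i) ≤ E) (e : ↥E) :
    ((fun i => IsCMField.complexConj (K i) (reflexNormFrom (K i) (Φ i) E e)) * fun i => reflexNormFrom (K i) (Φ i) E e) =
      algebraMap ℚ (Π i, K i) (Algebra.norm ℚ e) := by
  funext i
  rw [Pi.mul_apply, Pi.algebraMap_apply, mul_comm]
  exact reflexNormFrom_mul_complexConj_reflexNormFrom (K i) (Φ i) E (hE i) e

omit [DecidableEq ι] in
/-- **The rational torus element of `e ∈ E^×` lies in `GSp_δ(ℚ)`**: there is `q ∈ GSp_δ(ℚ)` with matrix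
`actMatrix (N_{E,Φᵢ}(e))ᵢ` and multiplier `Nm_{E/ℚ}(e)`. [cite: Milne2005ShimuraVarieties, Def. 12.8 (60)–(61) p. 114]
[cite: Deligne1971TravauxShimura, 3.9 p. 140] -/
theorem exists_gspRational_coe_eq_actMatrix_reflexNormFrom (hE : ∀ i, traceField (Φ i) ≤ E) (e : (↥E)ˣ) :
    ∃ q : gspRational δ,
      ((q : GL (Fin g ⊕ Fin g) ℚ) : Matrix (Fin g ⊕ Fin g) (Fin g ⊕ Fin g) ℚ) =
          c.actMatrix (fun i => reflexNormFrom (K i) (Φ i) E (e : ↥E)) ∧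
        ∃ ν : ℚˣ, (ν : ℚ) = Algebra.norm ℚ (e : ↥E) ∧ IsMultiplier (typeFormOver δ ℚ) (q : GL (Fin g ⊕ Fin g) ℚ) ν := by
  classical
  set x : Π i, K i := fun i => reflexNormFrom (K i) (Φ i) E (e : ↥E) with hx
  have hx0 : ∀ i, x i ≠ 0 := fun i => reflexNormFrom_ne_zero (K i) (Φ i) E (Units.ne_zero e)
  set y : Π i, K i := fun i => (x i)⁻¹ with hy
  have hxy : x * y = 1 := funext fun i => mul_inv_cancel₀ (hx0 i)
  have hyx : y * x = 1 := funext fun i => inv_mul_cancel₀ (hx0 i)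
  let u : GL (Fin g ⊕ Fin g) ℚ :=
    ⟨c.actMatrix x, c.actMatrix y, by rw [← c.actMatrix_mul, hxy, c.actMatrix_one],
      by rw [← c.actMatrix_mul, hyx, c.actMatrix_one]⟩
  have hne : Algebra.norm ℚ (e : ↥E) ≠ 0 := Algebra.norm_ne_zero_iff.2 (Units.ne_zero e)
  have hmul : IsMultiplier (typeFormOver δ ℚ) u (Units.mk0 _ hne) := by
    rw [isMultiplier_iff, Units.val_mk0]
    exact c.transpose_actMatrix_mul_typeFormOver_mul_actMatrix (conj_reflexNormFrom_mul_reflexNormFrom Φ E hE e)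
  exact ⟨⟨u, _, hmul⟩, rfl, Units.mk0 _ hne, Units.val_mk0 _, hmul⟩

/-- **Rational torus elements FIX the special point**: if `(c, J, Φ′)` is a special pair and `q ∈ GSp_δ(ℚ)` has matrix
`actMatrix x` for some `x ∈ F`, then `q·J·q⁻¹ = J` (`IsSpecial`: `J` commutes with `act(F)` over `ℝ`).
[cite: Deligne1971TravauxShimura, 4.18 p. 150] [cite: Milne2005ShimuraVarieties, Ex. 12.4 (b) p. 112] -/
theorem conjAct_eq_self_of_isSpecial {J : C0pm δ} {Φ' : ∀ i, Motives.CMType (K i)} (hJ : c.IsSpecial J Φ')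
    (q : gspRational δ) (x : Π i, K i)
    (hq : ((q : GL (Fin g ⊕ Fin g) ℚ) : Matrix (Fin g ⊕ Fin g) (Fin g ⊕ Fin g) ℚ) = c.actMatrix x) :
    conjAct δ (gspRationalToReal δ q) J = J :=
  conjAct_gspRationalToReal_eq_self_of_commute δ q J (by rw [hq]; exact hJ.1 x)

/-! ### §4. HEAD: the reciprocity element of a principal idèle acts trivially on `Sh_K(GSp_δ, S^±)(ℂ)` -/

/-- **The adelic image of the rational torus element is the reciprocity element of the principal idèle**: for `q` as in
`exists_gspRational_coe_eq_actMatrix_reflexNormFrom` and any `r ∈ GSp_δ(𝔸_f)` with matrix `c.cmRecipMatrix Φ E (e)_{𝔸}`,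
`r = q_{𝔸}`. [cite: Milne2005ShimuraVarieties, Def. 12.8 (60)–(61) p. 114] -/
theorem eq_gspRationalToFinAdelic_of_coe_eq_cmRecipMatrix_unitEmbedding (e : (↥E)ˣ) (q : gspRational δ)
    (hq : ((q : GL (Fin g ⊕ Fin g) ℚ) : Matrix (Fin g ⊕ Fin g) (Fin g ⊕ Fin g) ℚ) =
      c.actMatrix (fun i => reflexNormFrom (K i) (Φ i) E (e : ↥E)))
    (r : gspFinAdelic δ)
    (hr : ((r : GL (Fin g ⊕ Fin g) finAdeleQ) : Matrix (Fin g ⊕ Fin g) (Fin g ⊕ Fin g) finAdeleQ) =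
      c.cmRecipMatrix Φ E (FiniteAdeleRing.unitEmbedding (𝓞 ↥E) ↥E e)) :
    r = gspRationalToFinAdelic δ q := by
  apply Subtype.ext
  apply Units.ext
  rw [hr, cmRecipMatrix_unitEmbedding, coe_gspRationalToFinAdelic, ← hq]
  rfl

/-- **HEAD — principal idèles are invisible in (62).**  For a CM special pair `(c, J, Φ)`, a number field `E ⊆ ℂ`
containing every reflex field `E*(Φᵢ)`, `e ∈ E^×`, and ANY `r ∈ GSp_δ(𝔸_f)` whose matrix is the reciprocity element
`c.cmRecipMatrix Φ E (e)_{𝔸}` (the binder of ★ `SiegelRationalModel.IsCanonical`): `[J, r·aK] = [J, aK]` for every level `K`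
and every `a` — because `r` is the diagonal image of the rational torus element `act (N_{E,Φᵢ}(e))ᵢ ∈ GSp_δ(ℚ)`, which fixes `J`.
So the reciprocity law at the principal idèle `(e)` reads `σ • P = P`, as it must since `art_E((e)) = 1`
([Deligne1971TravauxShimura] 3.9: the reciprocity morphism of a torus is trivial on `E^×`).
[cite: Deligne1971TravauxShimura, 3.9 p. 140, Déf. 3.13 p. 141, 4.18 p. 150] [cite: Milne2005ShimuraVarieties, Def. 12.8 (62) p. 114] -/
theorem SiegelShimuraSet.mk_cmRecip_unitEmbedding_mul {J : C0pm δ} (hJ : c.IsSpecial J Φ)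
    (hE : ∀ i, traceField (Φ i) ≤ E) (e : (↥E)ˣ) (r : gspFinAdelic δ)
    (hr : ((r : GL (Fin g ⊕ Fin g) finAdeleQ) : Matrix (Fin g ⊕ Fin g) (Fin g ⊕ Fin g) finAdeleQ) =
      c.cmRecipMatrix Φ E (FiniteAdeleRing.unitEmbedding (𝓞 ↥E) ↥E e))
    (L : Subgroup (gspFinAdelic δ)) (a : gspFinAdelic δ) :
    SiegelShimuraSet.mk δ L J (r * a) = SiegelShimuraSet.mk δ L J a := by
  obtain ⟨q, hq, -⟩ := c.exists_gspRational_coe_eq_actMatrix_reflexNormFrom Φ E hE e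
  rw [c.eq_gspRationalToFinAdelic_of_coe_eq_cmRecipMatrix_unitEmbedding Φ E e q hq r hr]
  exact SiegelShimuraSet.mk_rationalToFinAdelic_mul δ L q J (c.conjAct_eq_self_of_isSpecial hJ q _ hq) a

/-- **The same with the special pair's types `Φ′` possibly different from the `Φ` used for the reflex norms** (the
fixing of `J` only uses that `J` commutes with `act(F)`). [cite: Deligne1971TravauxShimura, 3.9 p. 140, 4.18 p. 150] -/
theorem SiegelShimuraSet.mk_cmRecip_unitEmbedding_mul' {J : C0pm δ} {Φ' : ∀ i, Motives.CMType (K i)}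
    (hJ : c.IsSpecial J Φ') (hE : ∀ i, traceField (Φ i) ≤ E) (e : (↥E)ˣ) (r : gspFinAdelic δ)
    (hr : ((r : GL (Fin g ⊕ Fin g) finAdeleQ) : Matrix (Fin g ⊕ Fin g) (Fin g ⊕ Fin g) finAdeleQ) =
      c.cmRecipMatrix Φ E (FiniteAdeleRing.unitEmbedding (𝓞 ↥E) ↥E e))
    (L : Subgroup (gspFinAdelic δ)) (a : gspFinAdelic δ) :
    SiegelShimuraSet.mk δ L J (r * a) = SiegelShimuraSet.mk δ L J a := by
  obtain ⟨q, hq, -⟩ := c.exists_gspRational_coe_eq_actMatrix_reflexNormFrom Φ E hE e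
  rw [c.eq_gspRationalToFinAdelic_of_coe_eq_cmRecipMatrix_unitEmbedding Φ E e q hq r hr]
  exact SiegelShimuraSet.mk_rationalToFinAdelic_mul δ L q J (c.conjAct_eq_self_of_isSpecial hJ q _ hq) a

/-- **Consistency of (62) with `E^× ⊆ ker art_E`, in the currency of ★ `SiegelRationalModel.IsCanonical`**: for ANY model
`R` over `ℚ` of ANY complex Siegel tower `Sg` (canonical or not), the right-hand side of (62) at a principal idèle equals the
point itself: `R.ptQ L [J, r·a] = R.ptQ L [J, a]`.  Hence `IsCanonical` applied with `s = (e)` and any `σ` with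
`art_E((e)) = σ|_{E^{ab}}` yields `σ • P = P` — no constraint beyond `σ` fixing the special points, as it must be.
[cite: Deligne1971TravauxShimura, Déf. 3.13 p. 141 and 3.9 p. 140] [cite: Milne2005ShimuraVarieties, Def. 12.8 (62) p. 114] -/
theorem SiegelRationalModel.ptQ_mk_cmRecip_unitEmbedding_mul {Sg : SiegelComplexRecordSystem g δ}
    (R : SiegelRationalModel g δ Sg) {J : C0pm δ} (hJ : c.IsSpecial J Φ) (hE : ∀ i, traceField (Φ i) ≤ E) (e : (↥E)ˣ)
    (r : gspFinAdelic δ)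
    (hr : ((r : GL (Fin g ⊕ Fin g) finAdeleQ) : Matrix (Fin g ⊕ Fin g) (Fin g ⊕ Fin g) finAdeleQ) =
      c.cmRecipMatrix Φ E (FiniteAdeleRing.unitEmbedding (𝓞 ↥E) ↥E e))
    (L : SiegelLevel δ) (a : gspFinAdelic δ) :
    R.ptQ L ((Sg.pts L).symm (SiegelShimuraSet.mk δ L.1 J (r * a))) =
      R.ptQ L ((Sg.pts L).symm (SiegelShimuraSet.mk δ L.1 J a)) := by
  rw [SiegelShimuraSet.mk_cmRecip_unitEmbedding_mul c Φ E hJ hE e r hr L.1 a]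

end CMStructure

end Literature.AlgebraicGeometry.ModuliOfAbelianVarieties

end
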